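import Mathlib
import Summits.ResolutionOfSingularities.ResolutionOfSingularities.Theorems.WeightedInvariantELadderTwoStage
import Summits.ResolutionOfSingularities.ResolutionOfSingularities.Theorems.WeightedInvariantKWildHomDrop
import Summits.ResolutionOfSingularities.ResolutionOfSingularities.Theorems.WeightedInvariantELadderAssemblyMeasure
import Summits.ResolutionOfSingularities.ResolutionOfSingularities.Theorems.WeightedInvariantELadderTwoBase
import HarnessLib

/-!
# SPEC (registrar res-L1-w43-plan-1 g12, E2-CENSUS v0 §5′ (Δ2′)): THE CONSEQUENCE-LEVEL SUCCESSOR INTERFACE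
# `Stage.SuccCompatible` AND THE COMPATIBLE LADDER `ELadder.ladder_assembly_compatible` (PROVED)

FINDING A (E2-CENSUS v0 §1): the e = 2 successor target `E2InvSucc` / `E2InvSuccH` quantifies over EVERY graded atlas of the
successor stage, while its measure `Stage.mu₂` reads the atlas (through `Stage.IsOrbitGeneric`).  The proof plan of record
(RULING #8) uses two facts about the successor built by the tree's quotient step, and nothing else about its atlas:
(over) every point READ by the successor stage (`genSing₂`: in the non-regular image, orbit-generic, stalk dimension ≤ 3)
that lies over the support of the centre lies over a point of the maximum locus `maxLocus₂`, and its local ring is the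
localisation of the cobordant algebra `cobordantAlgebra' u w` of ANY presentation `(u, w)` of the centre's stalk filtration
at a `t`-HOMOGENEOUS prime `𝔫 ∋ t⁻¹` off the vertex, the strict transform's local equation being the `t⁻¹`-free part `g` of
`f`; (off) every read point off the support lies over a read point `y` and its local ring is a localisation of `𝒪_{Y,y}[X]`
over `𝔪_y`, with the same local equation.  This module TYPES these two facts as a `Prop`-valued structure
`Stage.SuccCompatible ι S R S' π` ((over), (off), and (I0)₂ of the successor), splits the successor target into
  `E2InvSuccLocBody p ι J`  — the LOCAL DROP: a compatible successor has strictly smaller `mu₂` (door-typer work over the HOM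
                              rung: (c9′-hom)≤3 = `WeightedDropHom` at the points (over), (c10)≤3 at the points (off),
                              (c6)/(c-u) to move along the ring isomorphisms), and
  `E2StepBody p ι J`        — the STRUCTURED QUOTIENT STEP: the cobordant blow-up of an admissible canonical e = 2 centre
                              carries a successor stage that IS compatible (GradedAtlas work: the induced atlas of
                              `Atlas.gradedAtlas_succ_of_isRegularWeightedCentre`, the chart isomorphism
                              `ReesFiltration.chartIsoAffineModel`, and the orbit analysis U3/U4 of the census),
and PROVES the ladder that consumes them: `ELadder.ladder_assembly_compatible` (the text of `ladder_assembly_measure`,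
p541146, with the quotient step taken as the hypothesis `step` delivering a `Compat`-ible successor, and `succ` demanded
only for `Compat`-ible successors) and its e = 2 instance `e2_resolvable_of_loc`.
[OURS · candidate objects of the line; nothing here is a statement of Hironaka 2017 ([claim: Hironaka2017, status:
under-review]); AI planning, weaker than expert review.]
-/

noncomputable section

set_option linter.dupNamespace false

open CategoryTheory AlgebraicGeometry TopologicalSpace IsLocalRing
open Literature.AlgebraicGeometry.Resolution
open Summit.ResolutionOfSingularities.ResolutionOfSingularities.Theorems
open Summit.ResolutionOfSingularities.ResolutionOfSingularities.Cruxes.HypersurfaceCentreConstruction.LocalEngine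

/-! ## The interface -/

namespace Summit.ResolutionOfSingularities.ResolutionOfSingularities.Theorems.ELadderOne.Stage

variable {k : Type} [Field k] (ι : (R : Type) → [CommRing R] → R → Ordinal.{0})

/-- (over) THE LOCAL MODEL OVER THE CENTRE at the successor point `η'` over `y = π η'`: for EVERY presentation `(u, w)` of
the stalk filtration of the centre `R` at `y`, the local ring `𝒪_{Y',η'}` is the localisation of `cobordantAlgebra' u w`
at a `t`-HOMOGENEOUS prime `𝔫 ∋ t⁻¹` over `𝔪_y` and off the vertex, compatibly with `𝒪_{Y,y} → 𝒪_{Y',η'}`, and the local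
equation of the successor hypersurface is (a unit multiple of) the `t⁻¹`-free part `g` of the local equation of `X` at `y`.
[OURS · candidate] [folklore] -/
def SuccOverCentreAt (S : Stage k) (R : ReesAlgebraData S.Y) (S' : Stage k) (π : S'.Y ⟶ S.Y) (η' : S'.Y) : Prop :=
  ∀ (n : ℕ) (u : Fin n → S.Y.presheaf.stalk (π.base η')) (w : Fin n → ℕ),
    (∀ m : ℕ, weightedMonomialIdeal u w m = stalkIdeal (R.piece m) (π.base η')) →
    ∃ (𝔫 : Ideal (cobordantAlgebra' u w)) (_ : 𝔫.IsPrime),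
      IsTHomogeneous u w 𝔫 ∧ cobordantT' u w ∈ 𝔫 ∧
      (maximalIdeal (S.Y.presheaf.stalk (π.base η'))).map (algebraMap _ (cobordantAlgebra' u w)) ≤ 𝔫 ∧
      ¬ (extReesAlgebra.vertexIdeal (weightedMonomialIdeal u w) ≤ 𝔫) ∧
      ∃ e : Localization.AtPrime 𝔫 ≃+* S'.Y.presheaf.stalk η',
        (∀ s : S.Y.presheaf.stalk (π.base η'),
          e (algebraMap (cobordantAlgebra' u w) (Localization.AtPrime 𝔫) (algebraMap _ (cobordantAlgebra' u w) s)) =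
            (π.stalkMap η').hom s) ∧
        ∃ (a : ℕ) (g : cobordantAlgebra' u w),
          algebraMap _ (cobordantAlgebra' u w) (localGenerator S.i.ker (π.base η')) = cobordantT' u w ^ a * g ∧
          ¬ (cobordantT' u w ∣ g) ∧
          Associated (e (algebraMap (cobordantAlgebra' u w) (Localization.AtPrime 𝔫) g)) (localGenerator S'.i.ker η')

/-- (off) THE LOCAL MODEL OFF THE CENTRE at the successor point `η'` over `y = π η'`: `𝒪_{Y',η'}` is a localisation of
`𝒪_{Y,y}[X]` at a prime over `𝔪_y` (the torus factor), compatibly with `𝒪_{Y,y} → 𝒪_{Y',η'}`, with the same local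
equation. [OURS · candidate] [folklore] -/
def SuccOffCentreAt (S : Stage k) (S' : Stage k) (π : S'.Y ⟶ S.Y) (η' : S'.Y) : Prop :=
  ∃ (𝔮 : Ideal (Polynomial (S.Y.presheaf.stalk (π.base η')))) (_ : 𝔮.IsPrime),
    𝔮.comap (Polynomial.C : S.Y.presheaf.stalk (π.base η') →+* Polynomial (S.Y.presheaf.stalk (π.base η'))) =
      maximalIdeal (S.Y.presheaf.stalk (π.base η')) ∧
    ∃ e : Localization.AtPrime 𝔮 ≃+* S'.Y.presheaf.stalk η',
      (∀ s : S.Y.presheaf.stalk (π.base η'),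
        e (algebraMap _ (Localization.AtPrime 𝔮) (Polynomial.C s)) = (π.stalkMap η').hom s) ∧
      Associated (e (algebraMap _ (Localization.AtPrime 𝔮) (Polynomial.C (localGenerator S.i.ker (π.base η')))))
        (localGenerator S'.i.ker η')

/-- **`S'` (over `S` by `π`) IS A COMPATIBLE SUCCESSOR OF THE STAGE `S` ALONG THE CENTRE `R`** (consequence-level interface,
E2-CENSUS v0 §5′ (Δ2′)): the successor keeps (I0)₂, and every point it READS (`genSing₂`) lies either over a point of the
maximum locus with the local model (over), or over a read point off the support with the local model (off).
[OURS · candidate] [folklore] -/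
structure SuccCompatible (S : Stage k) (R : ReesAlgebraData S.Y) (S' : Stage k) (π : S'.Y ⟶ S.Y) : Prop where
  /-- the successor keeps the dimension datum -/
  invDim : S'.InvDim₂
  /-- read points over the support: over the maximum locus, cobordant local model at a `t`-homogeneous prime -/
  overCentre : ∀ η' ∈ S'.genSing₂, π.base η' ∈ R.support →
    π.base η' ∈ S.maxLocus₂ ι ∧ S.SuccOverCentreAt R S' π η'
  /-- read points off the support: over a read point, torus-factor local model -/
  offCentre : ∀ η' ∈ S'.genSing₂, π.base η' ∉ R.support →
    π.base η' ∈ S.genSing₂ ∧ S.SuccOffCentreAt S' π η'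

end Summit.ResolutionOfSingularities.ResolutionOfSingularities.Theorems.ELadderOne.Stage

/-! ## The compatible ladder (PROVED) -/

namespace Summit.ResolutionOfSingularities.ResolutionOfSingularities.Theorems.ELadder

open Summit.ResolutionOfSingularities.ResolutionOfSingularities.Theorems.ELadderOne

/-- **Ladder assembly for compatible successors.**  As `ladder_assembly_measure` (p541146), but the successor stage is
delivered by the hypothesis `step` (a structured quotient step producing a `Compat`-ible successor over the cobordant
blow-up `R'.plus` of the centre) and `succ` is demanded only for `Compat`-ible successors, in the WEAK form «the
successor keeps `Inv` and is either REGULAR or has strictly smaller measure» (a regular successor is resolvable outright, so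
no measure drop is needed at the last step — this matters for measures that may vanish on singular stages).
[cite: Wlodarczyk2022, §2.3.3, Thm 1.1.4 (5)] -/
theorem ladder_assembly_compatible.{u} {k : Type} [Field k] [PerfectField k] {W : Type u} [LT W] [WellFoundedLT W]
    (Inv : Stage k → Prop) (μ : Stage k → W) (Good : (S : Stage k) → ReesAlgebraData S.Y → Prop)
    (Compat : (S : Stage k) → ReesAlgebraData S.Y → (S' : Stage k) → (S'.Y ⟶ S.Y) → Prop)
    (centre : ∀ S : Stage k, Inv S → ¬ Scheme.IsRegular S.X →
      ∃ R : ReesAlgebraData S.Y, IsAdmissibleCentre S.f S.i.ker R ∧ S.i (genericPoint S.X) ∉ R.support ∧ Good S R)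
    (step : ∀ (S : Stage k), Inv S → ¬ Scheme.IsRegular S.X →
      ∀ (R : ReesAlgebraData S.Y), IsAdmissibleCentre S.f S.i.ker R → S.i (genericPoint S.X) ∉ R.support →
        Good S R → ∀ (R' : ReesFiltration S.Y), R'.ideal = R.piece →
      ∀ [Smooth (R'.πPlus ≫ S.f)] [IsSeparated (R'.πPlus ≫ S.f)] [QuasiCompact (R'.πPlus ≫ S.f)]
        [IsIntegral (R'.strictTransformPlus S.i.ker).subscheme]
        (hlp' : IsLocallyPrincipal (R'.strictTransformPlus S.i.ker).subschemeι.ker),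
      ∃ (V' : Scheme.{0}) (ρ : V' ⟶ S.V) (_ : IsIntegral V') (_ : IsProper ρ)
        (q' : (R'.strictTransformPlus S.i.ker).subscheme ⟶ V')
        (hq' : q' ≫ ρ ≫ S.g = (R'.strictTransformPlus S.i.ker).subschemeι ≫ R'.πPlus ≫ S.f)
        (𝒜' : GradedAtlas (S.j + 1) (R'.πPlus ≫ S.f) (R'.strictTransformPlus S.i.ker).subschemeι q'),
        Compat S R ⟨R'.plus, R'.πPlus ≫ S.f, (R'.strictTransformPlus S.i.ker).subscheme,
            (R'.strictTransformPlus S.i.ker).subschemeι, hlp', V', q', ρ ≫ S.g, hq', S.j + 1, 𝒜'⟩ R'.πPlus)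
    (succ : ∀ (S : Stage k), Inv S → ¬ Scheme.IsRegular S.X →
      ∀ (R : ReesAlgebraData S.Y), IsAdmissibleCentre S.f S.i.ker R → S.i (genericPoint S.X) ∉ R.support →
        Good S R → ∀ (S' : Stage k) (π : S'.Y ⟶ S.Y), Compat S R S' π →
          Inv S' ∧ (Scheme.IsRegular S'.X ∨ μ S' < μ S))
    (S : Stage k) (hInv : Inv S) : S.toPair.Resolvable := by
  -- a regular stage is resolvable outright (used at the base AND for a regular successor)
  have hreg_res : ∀ S₁ : Stage k, Scheme.IsRegular S₁.X → S₁.toPair.Resolvable := fun S₁ h =>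
    HypersurfacePair.resolvable_of_isRegular _ ((isRegular_iff_isRegular_image S₁.i).mp h)
  suffices h : ∀ (m : W) (S : Stage k), Inv S → μ S = m → S.toPair.Resolvable from
    h _ S hInv rfl
  intro m
  induction m using WellFoundedLT.induction with
  | ind m ih =>
  intro S hInv hm
  by_cases hreg : Scheme.IsRegular S.X
  · exact hreg_res S hreg
  · obtain ⟨R, hadm, hξ, hgood⟩ := centre S hInv hreg
    have hc : R.IsRegularWeightedCentre := hadm.1
    haveI : IsLocallyNoetherian S.Y := LocallyOfFiniteType.isLocallyNoetherian S.f
    have hY : Scheme.IsRegular S.Y := Scheme.IsRegular.of_smooth S.f (Scheme.isRegular_Spec (.of k))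
    let R' : ReesFiltration S.Y :=
      { ideal := R.piece
        ideal_zero := R.piece_zero
        antitone := antitone_piece hc
        mul_le := R.piece_mul_le }
    obtain ⟨hsm', hsep', hqc'⟩ :=
      WeightedThesis.GlobalCobordantPlus.smooth_πPlus_comp_of_isRegularWeightedCentre S.f R hc R' rfl
    haveI := hsm'; haveI := hsep'; haveI := hqc'
    obtain ⟨hint', hker⟩ :=
      DatumToEmbedded.StrictTransform.isIntegral_strictTransformPlus_of_not_mem_support S.i R hc R' rfl hξ
    haveI := hint'
    set I' := R'.strictTransformPlus S.i.ker with hI'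
    have hI'lp : IsLocallyPrincipal I' :=
      WeightedThesis.HypersurfacePreserved.isLocallyPrincipal_strictTransformPlus hY R hc R' rfl S.i.ker
        S.isLocallyPrincipal
    let i' := I'.subschemeι
    have hlp' : IsLocallyPrincipal i'.ker := by
      rw [Scheme.IdealSheafData.ker_subschemeι]; exact hI'lp
    -- the structured quotient step delivers a compatible successor stage
    obtain ⟨V', ρ, hV', hρ, q', hq'', 𝒜', hcompat⟩ := step S hInv hreg R hadm hξ hgood R' rfl hlp'
    haveI := hV'; haveI := hρ
    let S' : Stage k :=
      { Y := R'.plus, f := R'.πPlus ≫ S.f, X := (R'.strictTransformPlus S.i.ker).subscheme,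
        i := (R'.strictTransformPlus S.i.ker).subschemeι, isLocallyPrincipal := hlp',
        V := V', q := q', g := ρ ≫ S.g, hq := hq'', j := S.j + 1, atlas := 𝒜' }
    obtain ⟨hInv', hdisj⟩ : Inv S' ∧ (Scheme.IsRegular S'.X ∨ μ S' < μ S) :=
      succ S hInv hreg R hadm hξ hgood S' R'.πPlus hcompat
    -- a regular successor is resolvable outright; otherwise the measure dropped and the induction hypothesis applies
    have hres' : S'.toPair.Resolvable := by
      rcases hdisj with hreg' | hlt
      · exact hreg_res S' hreg'
      · exact ih _ (hm ▸ hlt) S' hInv' rfl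
    obtain ⟨n, hn⟩ := hres'
    refine ⟨n + 1, R, hadm, R', rfl, hsm', hsep', hqc', hI'lp, hint', ?_⟩
    have e : (@HypersurfacePair.mk k _ R'.plus (R'.πPlus ≫ S.f) hsm' hsep' hqc' I' hI'lp hint') =
        S'.toPair := by
      simp only [S', Stage.toPair, HypersurfacePair.ofKer]
      congr 1
      exact (Scheme.IdealSheafData.ker_subschemeι I').symm
    rw [← e] at hn
    exact hn

end Summit.ResolutionOfSingularities.ResolutionOfSingularities.Theorems.ELadder

/-! ## The e = 2 targets in the (Δ2′) cut -/

namespace Summit.ResolutionOfSingularities.ResolutionOfSingularities.Cruxes.HypersurfaceCentreConstruction.LocalEngine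

open Summit.ResolutionOfSingularities.ResolutionOfSingularities.Theorems.ELadderOne

/-- **E2 STRUCTURED QUOTIENT STEP (body)**: blowing up an admissible canonical e = 2 centre (generic point of `X` off the
support) yields, over the cobordant blow-up `R'.plus`, a successor stage with a graded atlas of rank `j + 1` that is a
COMPATIBLE successor (`Stage.SuccCompatible`: (I0)₂ kept, local models (over)/(off) at every read point).  The GradedAtlas
half of the e = 2 successor: induced atlas + chart isomorphism + orbit analysis ((c8-gr)≤3 on the orbit space enters at
«read points over the support lie over the maximum locus»; the rung is supplied by the `…H` form of the registered stub).
[OURS · candidate] [folklore] -/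
def E2StepBody (p : ℕ) (ι : (R : Type) → [CommRing R] → R → Ordinal.{0})
    (J : (R : Type) → [CommRing R] → R → ℕ → Ideal R) : Prop :=
  ∀ ⦃k : Type⦄ [Field k] [CharP k p] [PerfectField k] (S : Stage k), S.InvDim₂ → ¬ Scheme.IsRegular S.X →
    ∀ (R : ReesAlgebraData S.Y), IsAdmissibleCentre S.f S.i.ker R → S.i (genericPoint S.X) ∉ R.support →
      S.IsCanonicalCentre₂ ι J R → ∀ (R' : ReesFiltration S.Y), R'.ideal = R.piece →
    ∀ [Smooth (R'.πPlus ≫ S.f)] [IsSeparated (R'.πPlus ≫ S.f)] [QuasiCompact (R'.πPlus ≫ S.f)]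
      [IsIntegral (R'.strictTransformPlus S.i.ker).subscheme]
      (hlp' : IsLocallyPrincipal (R'.strictTransformPlus S.i.ker).subschemeι.ker),
    ∃ (V' : Scheme.{0}) (ρ : V' ⟶ S.V) (_ : IsIntegral V') (_ : IsProper ρ)
      (q' : (R'.strictTransformPlus S.i.ker).subscheme ⟶ V')
      (hq' : q' ≫ ρ ≫ S.g = (R'.strictTransformPlus S.i.ker).subschemeι ≫ R'.πPlus ≫ S.f)
      (𝒜' : GradedAtlas (S.j + 1) (R'.πPlus ≫ S.f) (R'.strictTransformPlus S.i.ker).subschemeι q'),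
      Stage.SuccCompatible ι S R ⟨R'.plus, R'.πPlus ≫ S.f, (R'.strictTransformPlus S.i.ker).subscheme,
          (R'.strictTransformPlus S.i.ker).subschemeι, hlp', V', q', ρ ≫ S.g, hq', S.j + 1, 𝒜'⟩ R'.πPlus

/-- **E2 LOCAL DROP (body)**: a compatible successor of a non-regular (I0)₂ stage along an admissible canonical e = 2 centre
is REGULAR or has strictly smaller `mu₂` (it keeps (I0)₂, which `SuccCompatible` carries; the disjunct «regular» covers the
last step, where `genSing₂' = ∅` and `mu₂' = 0` while nothing in the rung forces `mu₂ > 0`).  The local-algebra half of the e = 2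
successor: (c9′-hom)≤3 = `WeightedDropHom` at the read points over the centre, (c10)≤3 at the read points off it,
(c6)/(c-u) along the isomorphisms of the local models. [OURS · candidate] [folklore] -/
def E2InvSuccLocBody (p : ℕ) (ι : (R : Type) → [CommRing R] → R → Ordinal.{0})
    (J : (R : Type) → [CommRing R] → R → ℕ → Ideal R) : Prop :=
  ∀ ⦃k : Type⦄ [Field k] [CharP k p] [PerfectField k] (S : Stage k), S.InvDim₂ → ¬ Scheme.IsRegular S.X →
    ∀ (R : ReesAlgebraData S.Y), IsAdmissibleCentre S.f S.i.ker R → S.i (genericPoint S.X) ∉ R.support →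
      S.IsCanonicalCentre₂ ι J R →
    ∀ (S' : Stage k) (π : S'.Y ⟶ S.Y), Stage.SuccCompatible ι S R S' π →
      Scheme.IsRegular S'.X ∨ S'.mu₂ ι < S.mu₂ ι

/-- THE e = 2 CENTRE body (verbatim the conclusion of `E2Centre`, rung hypothesis stripped; = (Δ1)'s `E2CentreBody`). -/
def E2CentreBody' (p : ℕ) (ι : (R : Type) → [CommRing R] → R → Ordinal.{0})
    (J : (R : Type) → [CommRing R] → R → ℕ → Ideal R) : Prop :=
  ∀ ⦃k : Type⦄ [Field k] [CharP k p] [PerfectField k] (S : Stage k), S.InvDim₂ → ¬ Scheme.IsRegular S.X →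
    ∃ R : ReesAlgebraData S.Y, IsAdmissibleCentre S.f S.i.ker R ∧ S.i (genericPoint S.X) ∉ R.support ∧
      S.IsCanonicalCentre₂ ι J R

/-- **THE e = 2 ASSEMBLY IN THE (Δ2′) CUT, PROVED**: base + centre + structured step + local drop for ONE pair `(ι, J)` give
`AdmissiblyResolvableDim p 2` (`ELadder.ladder_assembly_compatible` with `Inv := InvDim₂`, `μ := mu₂ ι`,
`Good := IsCanonicalCentre₂ ι J`, `Compat := SuccCompatible ι`; `ELadderOne.e2_base` for the start). [OURS] [folklore] -/
theorem admissiblyResolvableDim_two_of_loc (p : ℕ) (ι : (R : Type) → [CommRing R] → R → Ordinal.{0})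
    (J : (R : Type) → [CommRing R] → R → ℕ → Ideal R)
    (hc : E2CentreBody' p ι J) (hstep : E2StepBody p ι J) (hs : E2InvSuccLocBody p ι J) :
    Summit.ResolutionOfSingularities.ResolutionOfSingularities.Theorems.AdmissiblyResolvableDim p 2 := by
  intro k _ _ _ P hdim _
  obtain ⟨S, hInv, _, hSP⟩ := ELadderOne.e2_base p P hdim
  rw [← hSP]
  exact ELadder.ladder_assembly_compatible (W := Ordinal.{0}) Stage.InvDim₂ (Stage.mu₂ ι)
    (fun S R => Stage.IsCanonicalCentre₂ ι J S R) (fun S R S' π => Stage.SuccCompatible ι S R S' π)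
    (fun S hI hr => hc S hI hr)
    (fun S hI hr R hadm hξ hgood R' hR' _ _ _ _ hlp' => hstep S hI hr R hadm hξ hgood R' hR' hlp')
    (fun S hI hr R hadm hξ hgood S' π hcompat => ⟨hcompat.invDim, hs S hI hr R hadm hξ hgood S' π hcompat⟩)
    S hInv

end Summit.ResolutionOfSingularities.ResolutionOfSingularities.Cruxes.HypersurfaceCentreConstruction.LocalEngine

end
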